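import Summits.CriticalPhenomena.PercolationContinuityZ3.Theorems.Transplant.SkelFrmFrom1RootHoldsQ3VNode
import Summits.CriticalPhenomena.PercolationContinuityZ3.Theorems.Transplant.PlanarSkeletonFrmQuasiDefs
import Summits.CriticalPhenomena.PercolationContinuityZ3.Theorems.Transplant.SkelFrmQuasi1ChoiceDefs
import Summits.CriticalPhenomena.PercolationContinuityZ3.Theorems.Transplant.SkelFrmQuasi1SlotTypes
import Summits.CriticalPhenomena.PercolationContinuityZ3.Theorems.Transplant.SkelFrmQuasiBChoiceCreep2
import Summits.CriticalPhenomena.PercolationContinuityZ3.Theorems.Transplant.SkelFrmQuasiBChoiceDefs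
import Summits.CriticalPhenomena.PercolationContinuityZ3.Theorems.Transplant.SkelFrmQuasiBChoiceLinks
import Summits.CriticalPhenomena.PercolationContinuityZ3.Theorems.Transplant.SkelFrmQuasiBChoiceResidC
import Summits.CriticalPhenomena.PercolationContinuityZ3.Theorems.Transplant.SkelFrmQuasiBChoiceResidF2
import Summits.CriticalPhenomena.PercolationContinuityZ3.Theorems.Transplant.SkelFrmQuasiBChoiceResidQV
import Summits.CriticalPhenomena.PercolationContinuityZ3.Theorems.Transplant.SkelFrmQuasiBChoiceResidR
import Summits.CriticalPhenomena.PercolationContinuityZ3.Theorems.Transplant.SkelFrmQuasiBChoiceRoomV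
import Summits.CriticalPhenomena.PercolationContinuityZ3.Theorems.Transplant.SkelFrmQuasiBParamsBridge0
import Summits.CriticalPhenomena.PercolationContinuityZ3.Theorems.Transplant.SkelFrmQuasiBParamsCorrKGLen3
import Summits.CriticalPhenomena.PercolationContinuityZ3.Theorems.Transplant.SkelFrmQuasiBParamsLF
import Summits.CriticalPhenomena.PercolationContinuityZ3.Theorems.Transplant.SkelFrmQuasiBParamsSlots
import Summits.CriticalPhenomena.PercolationContinuityZ3.Theorems.Transplant.SkelFrmQuasiBParamsSlotsS
import Summits.CriticalPhenomena.PercolationContinuityZ3.Theorems.Transplant.SkelFrmQuasiBParamsSlotsT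
import Summits.CriticalPhenomena.PercolationContinuityZ3.Theorems.Transplant.SkelFrmQuasi1SlotTypes
import Summits.CriticalPhenomena.PercolationContinuityZ3.Theorems.Transplant.SkelFrmQuasiBChoiceNums
import HarnessLib

/-!
# GEN-Q PORT (WAVE-Q table v0.8 section 2, row G271, U-level L?; captain R-6/R-7 2026-08-27: carrier token swap `PlanarSkeletonFrmFrom ↦ PlanarSkeletonFrmQuasi`)
# of the tree module «Transplant/SkelFrmFromBChoiceSlotsPx» (sha256 d094ee0c1d9b6f2b…) onto the quasi-step carrier `PlanarSkeletonFrmQuasi` (p507026): «SkelFrmQuasiBChoiceSlotsPx»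

ORIGINAL TITLE: 

builds on p205010 (kernel theorem, internal audit signed; external expert review pending) — nothing in this file uses p205010; NOTHING is claimed about any open node
((N3-b), the end state).  Lane `prim-bschramm`, seat `prim-bschramm-gen-1` (gen 5; WAVE-Q captain).  Helper file (`--supports stmt-CriticalPhenomena-4575 --as helper`).
PORT RULES (U-wave r1–r4 re-used, GEN-Q hunk classes of p3-g29 #6136): declaration order, names and proof texts are those of «SkelFrmFromBChoiceSlotsPx», byte-identical except
(i) the carrier token `PlanarSkeletonFrmFrom ↦ PlanarSkeletonFrmQuasi` in binders, `namespace`/`end` lines and qualified names (module names `SkelFrmFrom… ↦ SkelFrmQuasi…`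
in imports of already-ported rows); (ii) `Φ.step ↦ Φ.qstep` with the called Steps lemma replaced by its `…Q`/`_q` twin and the cost `Φ.M` threaded (none in this file unless
listed below); (iii) `Φ.cyl_connected ↦ Φ.cyl_reach` readers (none unless listed); (iv) graph-ball radii / window floors ×`Φ.M` (none unless listed); r2 (U-wave rule, tool T8 = p3-g30's inline_r2.py): the section `variable` binders that bind the carrier are inlined into 6 kept header(s) (the gate's dedup otherwise reads a carrier-free header as a restatement of the FrmFrom twin); (v) KS0 READER HUNK of record (L-KitS-1 / L-FLOORMAP-1 ①, stmt-g33's table #6324, tool T6): the (S0) kit data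
of «SkelFrmQuasiBChoiceNums» (G017) are N-parametrised and read at `N := KS.NQ Φ = 13·max Φ.M 1` — IN THIS FILE KS0.r₀0N ×4 (e.g. `KS0.R'0 κ Φ … ↦ KS0.R'0N κ Φ (KS.NQ Φ) …`), nothing else.  Carrier-free
residents stay imported/exported from the original «SkelFrmBChoiceSlotsPx» exactly as in the FrmFrom port.  Docstrings and citations are the original's.
Row G271 (gen-1 g5; THE TUPLE Px OF RECORD).
-/

noncomputable section

open scoped Classical

namespace Summit.CriticalPhenomena.PercolationContinuityZ3.Theorems.Transplant

open MeasureTheory Literature.Probability.Percolation Literature.Probability.LatticeModels SimpleGraph KNCells KNLevels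
open SkelConc (Consts)
open Skelφ.StepI (DataN DataNS OutNS)

namespace PlanarSkeletonFrmQuasi

export PlanarSkeletonNeg.Neg (K)  -- T3-auto: resident alias(es) replicated from the FrmFrom namespace
export PlanarSkeletonFrmFrom.NegB (RK)  -- T3-auto: resident alias(es) replicated from the FrmFrom namespace

namespace NegB

open Neg

/-! ## §1 The index-raising wrappers (K-2: evaluate an index-parametrised slot at `KS.RK t Drec mk + D`) -/

/-- **Raise the kit index of a box/width slot family**: `raiseF X mk D` reads `X (KS.RK t Drec mk + D)` at every record `Drec`. [this work] -/
def raiseF (X : ℕ → Neg.FSlot) (mk D : ℕ) : Neg.FSlot := fun κ _ _ _ _ _ Φ t p Drec => X (KS.RK t Drec mk + D) κ Φ t p Drec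

/-- **Raise the kit index of an excess/diameter slot family**. [this work] -/
def raiseG (X : ℕ → GSlot) (mk D : ℕ) : GSlot := fun κ _ _ _ _ _ Φ t p Drec g f => X (KS.RK t Drec mk + D) κ Φ t p Drec g f

/-- **Raise the kit index of an extra-pairs slot family**. [this work] -/
def raiseP (X : ℕ → PSlot) (mk D : ℕ) : PSlot := fun κ _ _ _ _ _ Φ t p Drec => X (KS.RK t Drec mk + D) κ Φ t p Drec

/-- **Raise the kit index of a creep/room slot family**. [this work] -/
def raiseC (X : ℕ → CSlot) (mk D : ℕ) : CSlot := fun κ _ _ _ _ _ Φ t p Drec g f i => X (KS.RK t Drec mk + D) κ Φ t p Drec g f i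

section At

variable (κ : Consts) {V : Type} [DecidableEq V] [Countable V] {G : SimpleGraph V} [G.LocallyFinite] (Φ : PlanarSkeletonFrmQuasi G) (t : V) (p : unitInterval)
  (Drec : DataNS V)

-- GEN-Q (R-2, captain 2026-08-27): `PlanarSkeletonFrmFrom.NegB.raiseF_at` is not in the used cone of the node top — not ported.

-- GEN-Q (R-2, captain 2026-08-27): `PlanarSkeletonFrmFrom.NegB.raiseG_at` is not in the used cone of the node top — not ported.

-- GEN-Q (R-2, captain 2026-08-27): `PlanarSkeletonFrmFrom.NegB.raiseP_at` is not in the used cone of the node top — not ported.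

-- GEN-Q (R-2, captain 2026-08-27): `PlanarSkeletonFrmFrom.NegB.raiseC_at` is not in the used cone of the node top — not ported.

end At

/-! ## §2 The `+ D` excess residual -/

/-- **The (R)/(C) excess residual with the two proxied window floors**: `exRD m D := exR0 m ⊔ (r₀0 m (RLD + D) + 3) ⊔ (r₀0 m (RB0 m + D) + 1)` — the U residual
«SkelFrmFromBChoiceResidR».exR0 at index `m` together with the long-link window floor at radius `RL + D` (`+ 3`: the (C) ledger's form, ≥ the (R)'s `+ 1`) and the
bridge window floor at radius `RB0 + D`. Lower bounds only. [this work] -/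
def exRD (m D : ℕ) : GSlot := fun κ _ _ _ _ _ Φ t p Drec g f =>
  max (exR0 m κ Φ t p Drec g f) (max (KS0.r₀0N (KS.NQ Φ) t Drec m (RLD κ Φ t p Drec g f + D) + 3) (KS0.r₀0N (KS.NQ Φ) t Drec m (KS.RB0 κ Φ t p Drec m + D) + 1))

/-- `exRD` dominates the U residual `exR0` and the two `+ D` window floors. [folklore] -/
theorem exRD_floors (κ : Consts) {V : Type} [DecidableEq V] [Countable V] {G : SimpleGraph V} [G.LocallyFinite] (Φ : PlanarSkeletonFrmQuasi G) (t : V)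
    (p : unitInterval) (Drec : DataNS V) (m D g f : ℕ) {ex : ℕ} (h : exRD m D κ Φ t p Drec g f ≤ ex) :
    exR0 m κ Φ t p Drec g f ≤ ex ∧ KS0.r₀0N (KS.NQ Φ) t Drec m (RLD κ Φ t p Drec g f + D) + 3 ≤ ex ∧ KS0.r₀0N (KS.NQ Φ) t Drec m (KS.RB0 κ Φ t p Drec m + D) + 1 ≤ ex := by
  unfold exRD at h
  simp only [max_le_iff] at h
  exact ⟨h.1, h.2.1, h.2.2⟩

/-! ## §3 The tuple at radius `D` -/

/-- **The box slot of record under proxies**: `gT m′ (gxQ m′ (gxR0 m′) (fxR m′))` at the raised index. [this work] -/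
def gvPx (D : ℕ) : Neg.FSlot := raiseF (fun m => KS.gT m (gxQ m (gxR0 m) (fxR m))) 0 D

/-- **The width slot of record under proxies**: `fT m′ (fxQ m′ (fxR m′))` at the raised index. [this work] -/
def fvPx (D : ℕ) : Neg.FSlot := raiseF (fun m => KS.fT m (fxQ m (fxR m))) 0 D

/-- **The extra-pairs slot of record under proxies**: `PR m′ (PxQ m′ (PxR m′))` at the raised index (kit pair, bridge pair, face pairs at `m′`). [this work] -/
def PvPx (D : ℕ) : PSlot := raiseP (fun m => KS.PR m (PxQ m (PxR m))) 0 D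

/-- **The excess slot of record under proxies**: `exQ m′ (exRD m′ D)` at the raised index. [this work] -/
def exPx (D : ℕ) : GSlot := raiseG (fun m => exQ m (exRD m D)) 0 D

/-- **The rim-diameter slot of record under proxies**: `mxQ (mxF m′)` at the raised index. [this work] -/
def mxPx (D : ℕ) : GSlot := raiseG (fun m => mxQ (mxF m)) 0 D

/-- **The creep slot of record under proxies**: `cR2W m′` at the raised index (gen-1's `cR2WPx 0 D`). [this work] -/
def cvPx (D : ℕ) : CSlot := raiseC cR2W 0 D

/-- **The forward-room slot of record under proxies**: `hFR m′` at the raised index (gen-1's `hFRPx 0 D`). [this work] -/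
def hvPx (D : ℕ) : CSlot := raiseC hFR 0 D

/-! ## §4 The values at a record (what the column tops rewrite with) -/

section Values

variable (κ : Consts) {V : Type} [DecidableEq V] [Countable V] {G : SimpleGraph V} [G.LocallyFinite] (Φ : PlanarSkeletonFrmQuasi G) (t : V) (p : unitInterval)
  (Drec : DataNS V) (D : ℕ)

/-- The box slot at a record (by `rfl`). [folklore] -/
theorem gvPx_at (κ : Consts) {V : Type} [DecidableEq V] [Countable V] {G : SimpleGraph V} [G.LocallyFinite] (Φ : PlanarSkeletonFrmQuasi G) (t : V) (p : unitInterval) (Drec : DataNS V) (D : ℕ) : gvPx D κ Φ t p Drec = KS.gT (KS.RK t Drec 0 + D) (gxQ (KS.RK t Drec 0 + D) (gxR0 (KS.RK t Drec 0 + D)) (fxR (KS.RK t Drec 0 + D))) κ Φ t p Drec := rfl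

/-- The width slot at a record (by `rfl`). [folklore] -/
theorem fvPx_at (κ : Consts) {V : Type} [DecidableEq V] [Countable V] {G : SimpleGraph V} [G.LocallyFinite] (Φ : PlanarSkeletonFrmQuasi G) (t : V) (p : unitInterval) (Drec : DataNS V) (D : ℕ) : fvPx D κ Φ t p Drec = KS.fT (KS.RK t Drec 0 + D) (fxQ (KS.RK t Drec 0 + D) (fxR (KS.RK t Drec 0 + D))) κ Φ t p Drec := rfl

/-- The extra-pairs slot at a record (by `rfl`). [folklore] -/
theorem PvPx_at (κ : Consts) {V : Type} [DecidableEq V] [Countable V] {G : SimpleGraph V} [G.LocallyFinite] (Φ : PlanarSkeletonFrmQuasi G) (t : V) (p : unitInterval) (Drec : DataNS V) (D : ℕ) : PvPx D κ Φ t p Drec = KS.PR (KS.RK t Drec 0 + D) (PxQ (KS.RK t Drec 0 + D) (PxR (KS.RK t Drec 0 + D))) κ Φ t p Drec := rfl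

/-- The excess slot at a record (by `rfl`). [folklore] -/
theorem exPx_at (κ : Consts) {V : Type} [DecidableEq V] [Countable V] {G : SimpleGraph V} [G.LocallyFinite] (Φ : PlanarSkeletonFrmQuasi G) (t : V) (p : unitInterval) (Drec : DataNS V) (D : ℕ) (g f : ℕ) : exPx D κ Φ t p Drec g f = exQ (KS.RK t Drec 0 + D) (exRD (KS.RK t Drec 0 + D) D) κ Φ t p Drec g f := rfl

-- GEN-Q (R-2, captain 2026-08-27): `PlanarSkeletonFrmFrom.NegB.mxPx_at` is not in the used cone of the node top — not ported.

/-- The creep slot at a record (by `rfl`). [folklore] -/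
theorem cvPx_at (κ : Consts) {V : Type} [DecidableEq V] [Countable V] {G : SimpleGraph V} [G.LocallyFinite] (Φ : PlanarSkeletonFrmQuasi G) (t : V) (p : unitInterval) (Drec : DataNS V) (D : ℕ) (g f : ℕ) (i : Fin 2) : cvPx D κ Φ t p Drec g f i = cR2W (KS.RK t Drec 0 + D) κ Φ t p Drec g f i := rfl

/-- The forward-room slot at a record (by `rfl`). [folklore] -/
theorem hvPx_at (κ : Consts) {V : Type} [DecidableEq V] [Countable V] {G : SimpleGraph V} [G.LocallyFinite] (Φ : PlanarSkeletonFrmQuasi G) (t : V) (p : unitInterval) (Drec : DataNS V) (D : ℕ) (g f : ℕ) (i : Fin 2) : hvPx D κ Φ t p Drec g f i = hFR (KS.RK t Drec 0 + D) κ Φ t p Drec g f i := rfl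

-- GEN-Q (R-2, captain 2026-08-27): `PlanarSkeletonFrmFrom.NegB.cvPx_eq` is not in the used cone of the node top — not ported.

-- GEN-Q (R-2, captain 2026-08-27): `PlanarSkeletonFrmFrom.NegB.hvPx_eq` is not in the used cone of the node top — not ported.

end Values

end NegB

end PlanarSkeletonFrmQuasi

end Summit.CriticalPhenomena.PercolationContinuityZ3.Theorems.Transplant

end
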